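import Mathlib
import Summits.CriticalPhenomena.CardyFormulaZ2.Theorems.CardySelfRefinementGradientComparabilityStubNonAxialShareBulkTopology
import Summits.CriticalPhenomena.CardyFormulaZ2.Theorems.CardySelfRefinementGradientComparabilityStubLayerCrosscutPockets
import Summits.CriticalPhenomena.CardyFormulaZ2.Theorems.CardySelfRefinementGradientComparabilityStubLayerQuadJordan
import Summits.CriticalPhenomena.CardyFormulaZ2.Theorems.CardySelfRefinementGradientComparabilityStubLayerDeadFingerTrim
import Summits.CriticalPhenomena.CardyFormulaZ2.Theorems.CardySelfRefinementGradientComparabilityStubPivotalUniformlySmall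
import Literature.Probability.Percolation.QuadCrossingFlip
import HarnessLib

/-!
# Boundary-layer surgery, topology brick (S3): dead fingers

Helper file of the registered stub `stub_layerLocalModification` (the deterministic
boundary-layer surgery) of the line `monotone-product-coordinates` (crux
`stmt-CriticalPhenomena-10269`, `…Theses.CardySelfRefinement.GradientComparability`).  Step (S3)
of the layer surgery: an axial lattice edge `e = {u, u'}` drawn (at mesh `δ`) inside the closed
carrier `[Q]` of a quad `Q`, through an interior point `m` of whose segment passes a cross-cut
`β` of the open quad `[Q]°` with BOTH ends on the open side `∂₁Q` (or both on `∂₃Q`), `β`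
meeting the drawing of the configuration `ω ∪ {e}` only at `m` and running straight across `e`
near `m`, is **dead**: if `Q` is crossed inside the drawing of `ω ∪ {e}` then it is already
crossed inside the drawing of `ω ∖ {e}` (`quad_bridge_deadFinger`, registered helper).  So such
an edge is pivotal for no configuration.

Proof.  By `quad_exists_jordanDomain` the open quad is a Jordan domain `J` whose boundary loop
runs through `∂₁Q, ∂₂Q, ∂₃Q, ∂₀Q` on the four quarter periods, and `β` is a cross-cut of `J`
between two parameters `0 < s < t < ¼`.  By `crosscut_sides_and_pockets` (Newman),
`J ∖ β = U₁ ⊔ U₂` where the pocket `U₁` has closure off `J.boundary (t, s + 1) ⊇ ∂₀Q ∪ ∂₂Q`,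
`[Q] ⊆ cl U₁ ∪ cl U₂`, `cl U₁ ∩ cl U₂ ⊆ β`, and the two halves of the segment of `e` leave `m`
into the two different sides (local two-sidedness of the cut).  A crossing `K` inside the
drawing of `ω ∪ {e}` meets `β` at most at `m`; its part `K ∩ cl U₂` is still compact connected
(two closed pieces of a connected set glued at one point are connected,
`isPreconnected_inter_of_subsingleton`) and still meets `∂₀Q` and `∂₂Q` (which miss `cl U₁`);
it contains no point of the half of `e` inside the pocket, and removing the other, now dangling,
half-open half of `e` (glued to the rest of the drawing at the lattice end only) leaves a
crossing inside the drawing of `ω ∖ {e}` (`isCrossing_trim`).  The case of `∂₃Q` is that of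
`∂₁Q` for the flipped quad `Quad.flip`.  Finally `not_isPivotal_Aloc_of_deadFinger`
(registered helper) reads this at mesh `η√2` through the `configOf` dictionary
`mem_configOf_iff_exists_isCrossing_openEdgeUnion`: such an edge is pivotal for the localised
crossing event `Aloc 1 ![Q] η` in no configuration.  No percolation, no named fact.
-/

noncomputable section

namespace Summit.CriticalPhenomena.CardyFormulaZ2.Theorems.CardySelfRefinement

open scoped Topology
open Filter Set MeasureTheory
open Literature.Probability.LatticeModels Literature.Probability.Percolation
open Literature.Probability.Percolation.QuadCrossing
open Summit.CriticalPhenomena.CardyFormulaZ2.Theses.CardySelfRefinement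
open Literature.Topology.PlaneTopology Literature.Probability.RandomPlanarGeometry

variable {D : Set ℂ} {δ : ℝ}

/-! ## Dead fingers -/

/-- **Dead finger, core** (cross-cut given by boundary parameters `0 < s < t < ¼` of the Jordan
domain `J = [Q]°` of `quad_exists_jordanDomain`).  See `quad_bridge_deadFinger`. -/
theorem deadFinger_core (hδ : 0 < δ) (Q : Quad D)
    (J : Literature.Probability.RandomPlanarGeometry.JordanDomain)
    (hJcar : J.carrier = interior Q.carrier) (hJcl : closure J.carrier = Q.carrier)
    (h0 : Q.side 0 = J.boundary '' Icc (3 / 4) 1) (h2 : Q.side 2 = J.boundary '' Icc (1 / 4) (1 / 2))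
    {s t : ℝ} (hs : 0 < s) (hst : s < t) (ht : t < 1 / 4) {β : Set ℂ}
    (hβ : J.IsCrosscut β (J.boundary s) (J.boundary t))
    {u u' : Site 2} (huu' : (zdGraph 2).Adj u u') {ω : BondConfig (Site 2)} {m : ℂ} {ρ : ℝ}
    (hsegQ : segment ℝ (meshPoint δ u) (meshPoint δ u') ⊆ Q.carrier)
    (h02 : Disjoint (segment ℝ (meshPoint δ u) (meshPoint δ u')) (Q.side 0 ∪ Q.side 2))
    (hm : m ∈ openSegment ℝ (meshPoint δ u) (meshPoint δ u'))
    (hβX : β ∩ openEdgeUnion δ (insert s(u, u') ω) ⊆ {m}) (hρ : 0 < ρ)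
    (hball : Metric.ball m ρ ⊆ interior Q.carrier)
    (hβball : β ∩ Metric.ball m ρ =
      Metric.ball m ρ ∩ {z | inner ℝ (z - m) (meshPoint δ u' - meshPoint δ u) = 0})
    (hcross : ∃ K, Q.IsCrossing K ∧ K ⊆ openEdgeUnion δ (insert s(u, u') ω)) :
    ∃ K, Q.IsCrossing K ∧ K ⊆ openEdgeUnion δ (ω \ {s(u, u')}) := by
  set p : ℂ := meshPoint δ u with hp
  set p' : ℂ := meshPoint δ u' with hp'
  set X : Set ℂ := openEdgeUnion δ (ω \ {s(u, u')}) with hXdef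
  have hne : p ≠ p' := by
    intro h
    apply huu'.ne
    have h0 := congrArg Complex.re h
    have h1 := congrArg Complex.im h
    simp only [hp, hp', meshPoint_re, meshPoint_im] at h0 h1
    have h0' : u 0 = u' 0 := by exact_mod_cast (mul_left_cancel₀ hδ.ne' h0)
    have h1' : u 1 = u' 1 := by exact_mod_cast (mul_left_cancel₀ hδ.ne' h1)
    funext i
    fin_cases i
    · exact h0'
    · exact h1'
  obtain ⟨K, hK, hKXp⟩ := hcross
  -- Newman's two sides of the cut, pockets, local sides
  obtain ⟨U₁, U₂, h₁o, h₂o, -, -, hdisj, hunion, hf₁, hf₂, hpock₁, -, hloc⟩ :=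
    crosscut_sides_and_pockets J β s t hst (by linarith) hβ
  obtain ⟨hcov', hinter⟩ :=
    crosscut_closure_cover J β U₁ U₂ s t hst (by linarith) hβ h₁o h₂o hdisj hunion hf₁ hf₂
  have hcov : Q.carrier ⊆ closure U₁ ∪ closure U₂ := hJcl ▸ hcov'
  -- `∂₀Q ∪ ∂₂Q` misses the closed pocket
  have hp02 : ∀ z ∈ Q.side 0 ∪ Q.side 2, z ∉ closure U₁ := by
    rintro z (hz | hz)
    · rw [h0] at hz
      obtain ⟨w, hw, rfl⟩ := hz
      exact hpock₁ w ⟨by linarith [hw.1], by linarith [hw.2]⟩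
    · rw [h2] at hz
      obtain ⟨w, hw, rfl⟩ := hz
      exact hpock₁ w ⟨by linarith [hw.1], by linarith [hw.2]⟩
  -- the drawing of `ω ∪ {e}` is the drawing of `ω ∖ {e}` plus the segment of `e`
  have hsegXp : segment ℝ p p' ⊆ openEdgeUnion δ (insert s(u, u') ω) :=
    segment_subset_openEdgeUnion' δ huu' (mem_insert _ _)
  have hXp : openEdgeUnion δ (insert s(u, u') ω) ⊆ X ∪ segment ℝ p p' := by
    intro z hz
    obtain ⟨x, y, hxy, hω, hzseg⟩ := mem_openEdgeUnion_iff.1 hz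
    by_cases hexy : s(x, y) = s(u, u')
    · right
      rcases Sym2.eq_iff.1 hexy with ⟨hx, hy⟩ | ⟨hx, hy⟩
      · rw [hx, hy] at hzseg
        exact hzseg
      · rw [hx, hy, segment_symm] at hzseg
        exact hzseg
    · left
      refine mem_openEdgeUnion_iff.2 ⟨x, y, hxy, ⟨?_, hexy⟩, hzseg⟩
      exact (mem_insert_iff.1 hω).resolve_left hexy
  have hXseg : X ∩ segment ℝ p p' ⊆ {p, p'} := by
    rintro z ⟨hzX, hzs⟩
    have hzT : z ∈ openEdgeUnion δ ({s(u, u')} : BondConfig (Site 2)) :=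
      segment_subset_openEdgeUnion' δ (ω := {s(u, u')}) huu' (mem_singleton _) hzs
    obtain ⟨v, rfl, -, y', -, hy'⟩ := exists_vertex_of_mem_inter hδ
      (S := ω \ {s(u, u')}) (T := {s(u, u')}) (fun e he heT => he.2 heT) hzX hzT
    rcases Sym2.eq_iff.1 (mem_singleton_iff.1 hy') with ⟨rfl, -⟩ | ⟨rfl, -⟩
    · exact Or.inl rfl
    · exact Or.inr rfl
  have hXc : IsClosed X := isClosed_openEdgeUnion hδ _
  have hKX : K ⊆ X ∪ segment ℝ p p' := hKXp.trans hXp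
  have hKβ : K ∩ β ⊆ {m} := fun z hz => hβX ⟨hz.2, hKXp hz.1⟩
  have hsegβ : segment ℝ p p' ∩ β ⊆ {m} := fun z hz => hβX ⟨hz.2, hsegXp hz.1⟩
  have hsegcov : segment ℝ p p' ⊆ closure U₁ ∪ closure U₂ := hsegQ.trans hcov
  -- local two-sidedness at `m`: the two open half-balls
  have hmβ : m ∈ β := by
    have : m ∈ β ∩ Metric.ball m ρ := by
      rw [hβball]; exact ⟨Metric.mem_ball_self hρ, by simp⟩
    exact this.1
  set P : Set ℂ := Metric.ball m ρ ∩ {z | inner ℝ (z - m) (p' - p) < 0} with hPdef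
  set P' : Set ℂ := Metric.ball m ρ ∩ {z | inner ℝ (z - m) (p - p') < 0} with hP'def
  have hneg : ∀ z, inner ℝ (z - m) (p - p') = -inner ℝ (z - m) (p' - p) := fun z => by
    rw [← inner_neg_right, neg_sub]
  have hconv : ∀ v : ℂ, Convex ℝ (Metric.ball m ρ ∩ {z | inner ℝ (z - m) v < 0}) := by
    intro v
    have : {z : ℂ | inner ℝ (z - m) v < 0} = (innerSL ℝ v : ℂ →ₗ[ℝ] ℝ) ⁻¹' Iio (inner ℝ v m) := by
      ext z
      simp only [mem_setOf_eq, mem_preimage, mem_Iio, ContinuousLinearMap.coe_coe,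
        innerSL_apply_apply, inner_sub_left, real_inner_comm m v, sub_neg]
      rw [real_inner_comm z v]
    rw [this]
    exact (convex_ball m ρ).inter ((convex_Iio _).linear_preimage _)
  have hVPP : Metric.ball m ρ \ β ⊆ P ∪ P' := by
    rintro z ⟨hzb, hzβ⟩
    have hz0 : inner ℝ (z - m) (p' - p) ≠ 0 := fun h0 => by
      have : z ∈ β ∩ Metric.ball m ρ := by rw [hβball]; exact ⟨hzb, h0⟩
      exact hzβ this.1
    rcases hz0.lt_or_gt with h | h
    · exact Or.inl ⟨hzb, h⟩
    · refine Or.inr ⟨hzb, ?_⟩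
      show inner ℝ (z - m) (p - p') < 0
      rw [hneg]; linarith
  have hPS : ∀ (v : ℂ), (∀ z, inner ℝ (z - m) v = 0 ↔ inner ℝ (z - m) (p' - p) = 0) →
      Metric.ball m ρ ∩ {z | inner ℝ (z - m) v < 0} ⊆ J.carrier \ β := by
    intro v hv z ⟨hzb, hzv⟩
    refine ⟨hJcar ▸ hball hzb, fun hzβ => ?_⟩
    have : z ∈ β ∩ Metric.ball m ρ := ⟨hzβ, hzb⟩
    rw [hβball] at this
    have h0 : inner ℝ (z - m) v = 0 := (hv z).2 this.2
    exact hzv.ne h0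
  have hPS₁ : P ⊆ J.carrier \ β := hPS (p' - p) fun z => Iff.rfl
  have hPS₂ : P' ⊆ J.carrier \ β := hPS (p - p') fun z => by rw [hneg, neg_eq_zero]
  rcases hloc m hmβ (Metric.ball m ρ) (Metric.ball_mem_nhds m hρ) P P' hVPP
    (hconv _).isPreconnected (hconv _).isPreconnected hPS₁ hPS₂ with ⟨hP₁, -⟩ | ⟨-, hP'₁⟩
  · -- the `p`-half of `e` leaves `m` into the pocket: trim towards `p'`
    have hseg₂ := segment_inter_subset_of_side hne hsegcov isClosed_closure isClosed_closure
      subset_closure hinter hsegβ hm hρ hP₁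
    exact isCrossing_trim Q hK hKX hXc isClosed_closure isClosed_closure hcov hinter hKβ hne hm
      hseg₂ hXseg h02 hp02
  · -- the `p'`-half of `e` leaves `m` into the pocket: trim towards `p`
    rw [segment_symm] at hsegcov hsegβ hKX hXseg h02
    rw [openSegment_symm] at hm
    have hseg₂ := segment_inter_subset_of_side hne.symm hsegcov isClosed_closure isClosed_closure
      subset_closure hinter hsegβ hm hρ hP'₁
    rw [Set.pair_comm] at hXseg
    exact isCrossing_trim Q hK hKX hXc isClosed_closure isClosed_closure hcov hinter hKβ hne.symm
      hm hseg₂ hXseg h02 hp02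


/-- **Dead finger on the open side `∂₁Q`** (chart-free form of `deadFinger_core`; see
`quad_bridge_deadFinger`). -/
theorem deadFinger_sideOne (hδ : 0 < δ) (Q : Quad D) {u u' : Site 2}
    (huu' : (zdGraph 2).Adj u u') {ω : BondConfig (Site 2)} {β : Set ℂ} {a b m : ℂ} {ρ : ℝ}
    (hsegQ : segment ℝ (meshPoint δ u) (meshPoint δ u') ⊆ Q.carrier)
    (h02 : Disjoint (segment ℝ (meshPoint δ u) (meshPoint δ u')) (Q.side 0 ∪ Q.side 2))
    (hm : m ∈ openSegment ℝ (meshPoint δ u) (meshPoint δ u'))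
    (hβ : IsSimpleArc β a b) (ha : a ∈ Q.side 1) (hb : b ∈ Q.side 1)
    (ha02 : a ∉ Q.side 0 ∪ Q.side 2) (hb02 : b ∉ Q.side 0 ∪ Q.side 2)
    (hβQ : β \ {a, b} ⊆ interior Q.carrier)
    (hβX : β ∩ openEdgeUnion δ (insert s(u, u') ω) ⊆ {m}) (hρ : 0 < ρ)
    (hball : Metric.ball m ρ ⊆ interior Q.carrier)
    (hβball : β ∩ Metric.ball m ρ =
      Metric.ball m ρ ∩ {z | inner ℝ (z - m) (meshPoint δ u' - meshPoint δ u) = 0})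
    (hcross : ∃ K, Q.IsCrossing K ∧ K ⊆ openEdgeUnion δ (insert s(u, u') ω)) :
    ∃ K, Q.IsCrossing K ∧ K ⊆ openEdgeUnion δ (ω \ {s(u, u')}) := by
  obtain ⟨J, hJcar, hJcl, h1, h2, -, h0, hJfr, hdict⟩ := quad_exists_jordanDomain D Q
  -- the two ends have boundary parameters in the open quarter period `(0, ¼)`
  have hpar : ∀ c ∈ Q.side 1, c ∉ Q.side 0 ∪ Q.side 2 →
      ∃ sc ∈ Ioo (0 : ℝ) (1 / 4), c = J.boundary sc := by
    intro c hc hc02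
    rw [h1] at hc
    obtain ⟨sc, hsc, rfl⟩ := hc
    refine ⟨sc, ⟨?_, ?_⟩, rfl⟩
    · rcases hsc.1.eq_or_lt with h | h
      · refine absurd (Or.inl ?_) hc02
        have key := (hdict 0 ⟨le_rfl, zero_le_one⟩).1
        rw [zero_div] at key
        rw [← h, key, Quad.side_zero_eq]
        exact ⟨_, rfl, rfl⟩
      · exact h
    · rcases hsc.2.lt_or_eq with h | h
      · exact h
      · refine absurd (Or.inr ?_) hc02
        have key := (hdict 0 ⟨le_rfl, zero_le_one⟩).2.1
        rw [add_zero] at key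
        rw [h, key, Quad.side_two_eq]
        exact ⟨_, rfl, rfl⟩
  obtain ⟨sa, hsa, rfl⟩ := hpar a ha ha02
  obtain ⟨sb, hsb, rfl⟩ := hpar b hb hb02
  have hfr : ∀ v, J.boundary v ∈ frontier J.carrier := J.boundary_mem_frontier
  have hab : sa ≠ sb := fun h => hβ.ne (by rw [h])
  rcases hab.lt_or_gt with hlt | hlt
  · have hβc : J.IsCrosscut β (J.boundary sa) (J.boundary sb) :=
      ⟨hβ, hfr sa, hfr sb, hβ.ne, hJcar.symm ▸ hβQ⟩
    exact deadFinger_core hδ Q J hJcar hJcl h0 h2 hsa.1 hlt hsb.2 hβc huu' hsegQ h02 hm hβX hρ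
      hball hβball hcross
  · have hβc : J.IsCrosscut β (J.boundary sb) (J.boundary sa) :=
      ⟨hβ.symm, hfr sb, hfr sa, hβ.ne.symm, hJcar.symm ▸ (Set.pair_comm _ _ ▸ hβQ)⟩
    exact deadFinger_core hδ Q J hJcar hJcl h0 h2 hsb.1 hlt hsa.2 hβc huu' hsegQ h02 hm hβX hρ
      hball hβball hcross

/-- **Dead fingers** (brick (S3) of the boundary-layer surgery `stub_layerLocalModification`;
registered helper).  Let `Q` be a quad, `e = {u, u'}` a lattice edge whose closed segment, drawn
at mesh `δ > 0`, lies in `[Q]` off `∂₀Q ∪ ∂₂Q`, `m` an interior point of that segment, and `β`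
a simple arc from `a` to `b` with both ends on the side `∂₁Q` (or both on `∂₃Q`) but off
`∂₀Q ∪ ∂₂Q`, all other points in the open quad `[Q]°`, meeting the drawing of `ω ∪ {e}` at most
at `m`, and coinciding inside a ball `B(m, ρ) ⊆ [Q]°` with the diameter of the ball perpendicular
to `e`.  If `Q` is crossed inside the drawing of `ω ∪ {e}`, then `Q` is crossed inside the
drawing of `ω ∖ {e}`: the edge `e` is pivotal for the crossing of `Q` in no configuration. -/
theorem quad_bridge_deadFinger : ∀ (D : Set ℂ) (δ : ℝ), 0 < δ → ∀ (Q : Quad D) (u u' : Site 2) (ω : BondConfig (Site 2)) (β : Set ℂ) (a b m : ℂ) (ρ : ℝ), (zdGraph 2).Adj u u' → segment ℝ (meshPoint δ u) (meshPoint δ u') ⊆ Q.carrier → Disjoint (segment ℝ (meshPoint δ u) (meshPoint δ u')) (Q.side 0 ∪ Q.side 2) → m ∈ openSegment ℝ (meshPoint δ u) (meshPoint δ u') → Literature.Topology.PlaneTopology.IsSimpleArc β a b → (a ∈ Q.side 1 ∧ b ∈ Q.side 1 ∨ a ∈ Q.side 3 ∧ b ∈ Q.side 3) → a ∉ Q.side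 0 ∪ Q.side 2 → b ∉ Q.side 0 ∪ Q.side 2 → β \ {a, b} ⊆ interior Q.carrier → β ∩ openEdgeUnion δ (insert s(u, u') ω) ⊆ {m} → 0 < ρ → Metric.ball m ρ ⊆ interior Q.carrier → β ∩ Metric.ball m ρ = Metric.ball m ρ ∩ {z | inner ℝ (z - m) (meshPoint δ u' - meshPoint δ u) = 0} → (∃ K, Q.IsCrossing K ∧ K ⊆ openEdgeUnion δ (insert s(u, u') ω)) → ∃ K, Q.IsCrossing K ∧ K ⊆ openEdgeUnion δ (ω \ {s(u, u')}) := by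
  intro D δ hδ Q u u' ω β a b m ρ huu' hsegQ h02 hm hβ h13 ha02 hb02 hβQ hβX hρ hball hβball hcross
  rcases h13 with ⟨ha, hb⟩ | ⟨ha, hb⟩
  · exact deadFinger_sideOne hδ Q huu' hsegQ h02 hm hβ ha hb ha02 hb02 hβQ hβX hρ hball hβball
      hcross
  · -- both ends on `∂₃Q`: the flipped quad `(x, y) ↦ Q (x, 1 - y)` has the same carrier, the
    -- same sides `∂₀, ∂₂` and crossings, and exchanges `∂₁` and `∂₃`
    rw [← Quad.flip_exists_isCrossing_iff] at hcross ⊢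
    rw [← Quad.flip_carrier Q] at hsegQ hβQ hball
    rw [← Quad.flip_side_zero Q, ← Quad.flip_side_two Q] at h02 ha02 hb02
    rw [← Quad.flip_side_one Q] at ha hb
    exact deadFinger_sideOne hδ Q.flip huu' hsegQ h02 hm hβ ha hb ha02 hb02 hβQ hβX hρ hball
      hβball hcross

/-- **Dead fingers carry no pivotal mass** (registered helper).  In the setting of
`quad_bridge_deadFinger` at the mesh `η√2` of the self-refinement model, with the cross-cut `β`
meeting the whole drawn lattice `openEdgeUnion (η√2) univ` only at `m`, the edge `{u, u'}` is
pivotal for the localised crossing event `Aloc 1 ![Q] η` of the single quad `Q` in NO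
configuration `ω`. -/
theorem not_isPivotal_Aloc_of_deadFinger : ∀ (η : ℝ), 0 < η → ∀ (Q : Quad (Set.univ : Set ℂ)) (u u' : Site 2) (β : Set ℂ) (a b m : ℂ) (ρ : ℝ), (zdGraph 2).Adj u u' → segment ℝ (meshPoint (η * Real.sqrt 2) u) (meshPoint (η * Real.sqrt 2) u') ⊆ Q.carrier → Disjoint (segment ℝ (meshPoint (η * Real.sqrt 2) u) (meshPoint (η * Real.sqrt 2) u')) (Q.side 0 ∪ Q.side 2) → m ∈ openSegment ℝ (meshPoint (η * Real.sqrt 2) u) (meshPoint (η * Real.sqrt 2) u') → Literature.Topology.PlaneTopology.IsSimpleArc β a b → (a ∈ Q.side 1 ∧ b ∈ Q.side 1 ∨ a ∈ Q.side 3 ∧ b ∈ Q.side 3) → a ∉ Q.side 0 ∪ Q.side 2 → b ∉ Q.side 0 ∪ Q.side 2 → β \ {a, b} ⊆ interior Q.carrier → β ∩ openEdgeUnion (η * Real.sqrt 2) Set.univ ⊆ {m} → 0 < ρ → Metric.ball m ρ ⊆ interior Q.carrier → β ∩ Metric.ball m ρ = Metric.ball m ρ ∩ {z | inner ℝ (z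 - m) (meshPoint (η * Real.sqrt 2) u' - meshPoint (η * Real.sqrt 2) u) = 0} → ∀ ω : BondConfig (Site 2), ¬ IsPivotal (Aloc 1 ![Q] η) s(u, u') ω := by
  intro η hη Q u u' β a b m ρ huu' hsegQ h02 hm hβ h13 ha02 hb02 hβQ hβU hρ hball hβball ω hpiv
  set δ : ℝ := η * Real.sqrt 2 with hδdef
  have hδ : 0 < δ := by positivity
  set W : Set (Sym2 (Site 2)) := window 1 ![Q] η with hW
  have hWE : W ⊆ (zdGraph 2).edgeSet := by
    intro x hx
    simp only [hW, window, edgesNear, Set.mem_iUnion, Set.mem_inter_iff] at hx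
    obtain ⟨-, -, hx⟩ := hx
    exact hx
  -- the crossing dictionary for configurations inside the window
  have hmem : ∀ ω' : BondConfig (Site 2),
      ω' ∈ Aloc 1 ![Q] η ↔ ∃ K, Q.IsCrossing K ∧ K ⊆ openEdgeUnion δ (ω' ∩ W) := by
    intro ω'
    change (∀ i, ![Q] i ∈ configOf squareLatticeEmbedding.z η Set.univ (ω' ∩ W)) ↔ _
    simp only [Fin.forall_fin_one, Matrix.cons_val_fin_one]
    exact mem_configOf_iff_exists_isCrossing_openEdgeUnion hη (Set.inter_subset_right.trans hWE) Q
  set ω₀ : BondConfig (Site 2) := (ω \ {s(u, u')}) ∩ W with hω₀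
  have hsub : insert s(u, u') ω ∩ W ⊆ insert s(u, u') ω₀ := by
    rintro x ⟨hx, hxW⟩
    by_cases hxe : x = s(u, u')
    · exact hxe ▸ mem_insert _ _
    · exact mem_insert_of_mem _ ⟨⟨(mem_insert_iff.1 hx).resolve_left hxe, hxe⟩, hxW⟩
  have fwd : insert s(u, u') ω ∈ Aloc 1 ![Q] η → ω \ {s(u, u')} ∈ Aloc 1 ![Q] η := by
    rw [hmem, hmem]
    rintro ⟨K, hK, hKX⟩
    have hβX : β ∩ openEdgeUnion δ (insert s(u, u') ω₀) ⊆ {m} := fun z hz =>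
      hβU ⟨hz.1, openEdgeUnion_mono δ (Set.subset_univ _) hz.2⟩
    obtain ⟨K', hK', hK'X⟩ := quad_bridge_deadFinger _ δ hδ Q u u' ω₀ β a b m ρ huu' hsegQ h02
      hm hβ h13 ha02 hb02 hβQ hβX hρ hball hβball ⟨K, hK, hKX.trans (openEdgeUnion_mono δ hsub)⟩
    exact ⟨K', hK', hK'X.trans (openEdgeUnion_mono δ Set.sdiff_subset)⟩
  have bwd : ω \ {s(u, u')} ∈ Aloc 1 ![Q] η → insert s(u, u') ω ∈ Aloc 1 ![Q] η := by
    rw [hmem, hmem]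
    rintro ⟨K, hK, hKX⟩
    exact ⟨K, hK, hKX.trans (openEdgeUnion_mono δ (Set.inter_subset_inter_left _
      (Set.sdiff_subset.trans (Set.subset_insert _ _))))⟩
  rcases hpiv with ⟨h1, h2⟩ | ⟨h1, h2⟩
  · exact h2 (fwd h1)
  · exact h2 (bwd h1)

end Summit.CriticalPhenomena.CardyFormulaZ2.Theorems.CardySelfRefinement

end
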